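import Summits.AtomisticToContinuum.HydrodynamicLimit.Theorems.LambertianContactSwapLambertianEulerTailsZero
import Summits.AtomisticToContinuum.HydrodynamicLimit.Theorems.JParityClosureKineticEnergyTailsApriori
import HarnessLib

/-!
# `MaxSpeedBoundLog` (stmt-AtomisticToContinuum-9629), line `registered`: the static speed tail

Registered stub `stub_initialSpeedTailLog` of the birth skeleton
`Cruxes/MaxSpeedBoundLog/Lines/birth.lean` (namespace `…Cruxes.MaxSpeedBoundLog.Birth`): for
continuous profiles `a₀, θ₀ > 0`, `u₀`, EVERY `σ > 0` and every family of hard-sphere flows `Φ`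
there is `C₀` with

  `localGibbsLaw σ a₀ u₀ θ₀ N (Φ N) {z | ∃ i, C₀ √log(N+2) < ‖(z i).2‖} → 0`   (`N → ∞`).

Pure statics (the flow only fixes the type, `localGibbsLaw_eq`).  The file is organised as three
general lemmas — reusable at any level `ℓ_N` (e.g. `(N+1)^{1/24}` for the sibling crux
`MaxSpeedBoundPreShock`) — followed by the stub as a corollary:

* `localGibbsMeasure_existsFast_le_of_expMoment` — **sub-Gaussian max-speed tail at level `ℓ`,
  every `σ`**: if `∫ e^{a‖v‖²} dN(u₀(x), θ₀(x) id) ≤ K` uniformly in `x ∈ 𝕋³` (`a ≥ 0`), then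
  `localGibbsMeasure σ a₀ u₀ θ₀ N {∃ i, ℓ < ‖vᵢ‖} ≤ (N+1) K e^{-aℓ²}` for `ℓ ≥ 0`.  Proof: the
  disintegration bound `lintegral_meanVelObs_localGibbsMeasure_le` (conditionally on the positions
  the velocities are independent Gaussians; the position weight has total mass `Z⁻¹ Z ≤ 1`, so NO
  normalisability / smallness of `σ` is needed) gives `E[(N+1)⁻¹ ∑ᵢ e^{a‖vᵢ‖²}] ≤ K`, and on the
  event some term is `≥ e^{aℓ²}`: Markov (`mul_meas_ge_le_lintegral₀`).
* `exists_localGibbsMeasure_existsFast_le` — the same with `a > 0`, `K ≥ 0` produced by Fernique's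
  theorem on `ℝ³` and the compactness of `𝕋³` (`tailsZero_exists_lintegral_exp_gaussMeasure_le`:
  `θ₀ ≤ θ_max`, `‖u₀‖ ≤ U`).
* `exists_tendsto_localGibbsMeasure_existsFast_sqrtLog` — at the level `ℓ_N = C₀ √log(N+2)` with
  `C₀ = √(2/a)`: `(N+1) K e^{-aℓ_N²} = (N+1) K (N+2)^{-2} ≤ K/(N+1) → 0`, for every `σ`.

References: H. Spohn, *Large Scale Dynamics of Interacting Particles* (1991), Part I §2.3 (local
equilibrium states); X. Fernique, C. R. Acad. Sci. Paris 270 (1970) (Gaussian exponential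
moments); extreme values of Gaussian samples (folklore: `max ≍ √(2θ log N)`).
-/

noncomputable section

open scoped BigOperators Topology ENNReal
open MeasureTheory ProbabilityTheory Filter Set
open Literature.MathematicalPhysics.KineticTheory Literature.Analysis.FluidPDE

namespace Summit.AtomisticToContinuum.HydrodynamicLimit.Theorems

variable {a₀ θ₀ : T3 → ℝ} {u₀ : T3 → V3}

/-- **Sub-Gaussian tail of the maximal speed under the local Gibbs measure, at level `ℓ`, for
every `σ`.**  If the one-body exponential moment `∫ e^{a‖v‖²} dN(u₀(x), θ₀(x) id) ≤ K` holds
uniformly in `x ∈ 𝕋³` (`a ≥ 0`), then for every `σ`, `N` and `ℓ ≥ 0`,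
`localGibbsMeasure σ a₀ u₀ θ₀ N {z | ∃ i, ℓ < ‖(z i).2‖} ≤ (N+1) K e^{-aℓ²}`: Markov's inequality
for the empirical exponential moment `(N+1)⁻¹ ∑ᵢ e^{a‖vᵢ‖²}`, whose mean is `≤ K` by the
disintegration into positions and independent Gaussian velocities (total mass `≤ 1`, no
normalisability needed), and which is `≥ (N+1)⁻¹ e^{aℓ²}` on the event. -/
theorem localGibbsMeasure_existsFast_le_of_expMoment (ha : Continuous a₀) (hθ : Continuous θ₀)
    (hu : Continuous u₀) (ha0 : ∀ x, 0 ≤ a₀ x) (hθ0 : ∀ x, 0 < θ₀ x) {a : ℝ} (ha' : 0 ≤ a)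
    {K : ℝ}
    (hK : ∀ x : T3, ∫⁻ v, ENNReal.ofReal (Real.exp (a * ‖v‖ ^ 2)) ∂gaussMeasure (u₀ x) (θ₀ x) ≤
      ENNReal.ofReal K)
    (σ : ℝ) (N : ℕ) {ℓ : ℝ} (hℓ : 0 ≤ ℓ) :
    localGibbsMeasure σ a₀ u₀ θ₀ N {z | ∃ i, ℓ < ‖(z i).2‖} ≤
      ENNReal.ofReal (((N : ℝ) + 1) * K * Real.exp (-(a * ℓ ^ 2))) := by
  set μ := localGibbsMeasure σ a₀ u₀ θ₀ N with hμ
  -- the empirical exponential moment and its mean bound (disintegration, every `σ`)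
  set G : Config (N + 1) (Fin 3) T3 → ℝ≥0∞ := fun z =>
    ENNReal.ofReal (((N : ℝ) + 1)⁻¹ * ∑ i, Real.exp (a * ‖(z i).2‖ ^ 2)) with hG
  have hf : Measurable fun v : V3 => Real.exp (a * ‖v‖ ^ 2) :=
    Real.measurable_exp.comp ((measurable_norm.pow_const 2).const_mul a)
  have hGm : Measurable G :=
    (measurable_const.mul (Finset.measurable_sum _ fun i _ =>
      hf.comp (measurable_pi_apply i).snd)).ennreal_ofReal
  have hmean : ∫⁻ z, G z ∂μ ≤ ENNReal.ofReal K :=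
    lintegral_meanVelObs_localGibbsMeasure_le ha hθ hu ha0 hθ0 hf (fun v => (Real.exp_pos _).le)
      hK σ N
  -- Markov at the level `e = (N+1)⁻¹ e^{a ℓ²}`
  have hN : (0 : ℝ) < (N : ℝ) + 1 := by positivity
  set e : ℝ := ((N : ℝ) + 1)⁻¹ * Real.exp (a * ℓ ^ 2) with he
  have he0 : 0 < e := by positivity
  have hsub : {z : Config (N + 1) (Fin 3) T3 | ∃ i, ℓ < ‖(z i).2‖} ⊆
      {z | ENNReal.ofReal e ≤ G z} := by
    rintro z ⟨j, hj⟩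
    refine ENNReal.ofReal_le_ofReal (mul_le_mul_of_nonneg_left ?_ (inv_nonneg.2 hN.le))
    calc Real.exp (a * ℓ ^ 2) ≤ Real.exp (a * ‖(z j).2‖ ^ 2) := by
          refine Real.exp_le_exp.2 (mul_le_mul_of_nonneg_left ?_ ha')
          exact pow_le_pow_left₀ hℓ hj.le 2
      _ ≤ ∑ i, Real.exp (a * ‖(z i).2‖ ^ 2) :=
          Finset.single_le_sum (f := fun i => Real.exp (a * ‖(z i).2‖ ^ 2))
            (fun i _ => (Real.exp_pos _).le) (Finset.mem_univ j)
  have hmarkov : ENNReal.ofReal e * μ {z | ENNReal.ofReal e ≤ G z} ≤ ENNReal.ofReal K :=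
    (mul_meas_ge_le_lintegral₀ hGm.aemeasurable _).trans hmean
  have hε0 : ENNReal.ofReal e ≠ 0 := (ENNReal.ofReal_pos.2 he0).ne'
  calc μ {z | ∃ i, ℓ < ‖(z i).2‖} ≤ μ {z | ENNReal.ofReal e ≤ G z} := measure_mono hsub
    _ ≤ ENNReal.ofReal K / ENNReal.ofReal e := by
        rw [ENNReal.le_div_iff_mul_le (Or.inl hε0) (Or.inl ENNReal.ofReal_ne_top), mul_comm]
        exact hmarkov
    _ = ENNReal.ofReal (((N : ℝ) + 1) * K * Real.exp (-(a * ℓ ^ 2))) := by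
        rw [div_eq_mul_inv, ← ENNReal.ofReal_inv_of_pos he0,
          ← ENNReal.ofReal_mul' (inv_nonneg.2 he0.le)]
        congr 1
        rw [he, mul_inv, inv_inv, Real.exp_neg]
        ring

/-- **Sub-Gaussian tail of the maximal speed under the local Gibbs measure** (existential form,
every `σ`): for continuous `a₀ ≥ 0`, `θ₀ > 0`, `u₀` there are `a > 0` and `K ≥ 0` with
`localGibbsMeasure σ a₀ u₀ θ₀ N {z | ∃ i, ℓ < ‖(z i).2‖} ≤ (N+1) K e^{-aℓ²}` for all `σ`, `N` and
`ℓ ≥ 0` — Fernique's theorem for the standard Gaussian on `ℝ³` made uniform in the position by the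
compactness of `𝕋³` (`tailsZero_exists_lintegral_exp_gaussMeasure_le`), then
`localGibbsMeasure_existsFast_le_of_expMoment`. -/
theorem exists_localGibbsMeasure_existsFast_le (ha : Continuous a₀) (hθ : Continuous θ₀)
    (hu : Continuous u₀) (ha0 : ∀ x, 0 ≤ a₀ x) (hθ0 : ∀ x, 0 < θ₀ x) :
    ∃ a : ℝ, 0 < a ∧ ∃ K : ℝ, 0 ≤ K ∧ ∀ (σ : ℝ) (N : ℕ) (ℓ : ℝ), 0 ≤ ℓ →
      localGibbsMeasure σ a₀ u₀ θ₀ N {z | ∃ i, ℓ < ‖(z i).2‖} ≤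
        ENNReal.ofReal (((N : ℝ) + 1) * K * Real.exp (-(a * ℓ ^ 2))) := by
  obtain ⟨a, ha', K, hK⟩ :=
    LambertianContactSwapLambertianEulerTailsZero.tailsZero_exists_lintegral_exp_gaussMeasure_le
      hθ hu hθ0
  refine ⟨a, ha', max K 0, le_max_right _ _, fun σ N ℓ hℓ => ?_⟩
  exact localGibbsMeasure_existsFast_le_of_expMoment ha hθ hu ha0 hθ0 ha'.le
    (fun x => (hK x).trans (ENNReal.ofReal_le_ofReal (le_max_left _ _))) σ N hℓ

/-- **The maximal speed under the local Gibbs measure is `O(√log N)` in probability, for every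
`σ`.**  For continuous `a₀ ≥ 0`, `θ₀ > 0`, `u₀` there is `C₀ > 0` with
`localGibbsMeasure σ a₀ u₀ θ₀ N {z | ∃ i, C₀ √log(N+2) < ‖(z i).2‖} → 0` as `N → ∞`, for every
`σ`: with `a, K` from `exists_localGibbsMeasure_existsFast_le` and `C₀ = √(2/a)`,
`a (C₀ √log(N+2))² = log((N+2)²)`, so the bound is `(N+1) K (N+2)^{-2} ≤ K/(N+1) → 0`. -/
theorem exists_tendsto_localGibbsMeasure_existsFast_sqrtLog (ha : Continuous a₀)
    (hθ : Continuous θ₀) (hu : Continuous u₀) (ha0 : ∀ x, 0 ≤ a₀ x) (hθ0 : ∀ x, 0 < θ₀ x) :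
    ∃ C₀ : ℝ, 0 < C₀ ∧ ∀ σ : ℝ, Tendsto (fun N : ℕ => localGibbsMeasure σ a₀ u₀ θ₀ N
      {z | ∃ i, C₀ * Real.sqrt (Real.log ((N : ℝ) + 2)) < ‖(z i).2‖}) atTop (𝓝 0) := by
  obtain ⟨a, ha', K, hK0, hK⟩ := exists_localGibbsMeasure_existsFast_le ha hθ hu ha0 hθ0
  have h2a : (0 : ℝ) ≤ 2 / a := by positivity
  refine ⟨Real.sqrt (2 / a), Real.sqrt_pos.2 (by positivity), fun σ => ?_⟩
  refine tendsto_of_tendsto_of_tendsto_of_le_of_le tendsto_const_nhds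
    (tendsto_ofReal_div_succ_mul K 1) (fun _ => zero_le) fun N => ?_
  have hN0 : (0 : ℝ) ≤ (N : ℝ) := N.cast_nonneg
  have hlog : 0 ≤ Real.log ((N : ℝ) + 2) := Real.log_nonneg (by linarith)
  have hℓ : 0 ≤ Real.sqrt (2 / a) * Real.sqrt (Real.log ((N : ℝ) + 2)) := by positivity
  refine (hK σ N _ hℓ).trans (ENNReal.ofReal_le_ofReal ?_)
  -- `a ℓ_N² = log ((N+2)²)`
  have hsq : a * (Real.sqrt (2 / a) * Real.sqrt (Real.log ((N : ℝ) + 2))) ^ 2 =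
      Real.log (((N : ℝ) + 2) ^ 2) := by
    rw [mul_pow, Real.sq_sqrt h2a, Real.sq_sqrt hlog, Real.log_pow, Nat.cast_ofNat]
    field_simp
  rw [hsq, Real.exp_neg, Real.exp_log (by positivity)]
  push_cast
  rw [mul_one, ← div_eq_mul_inv, div_le_div_iff₀ (by positivity) (by positivity)]
  have h12 : ((N : ℝ) + 1) ^ 2 ≤ ((N : ℝ) + 2) ^ 2 := by nlinarith
  calc ((N : ℝ) + 1) * K * ((N : ℝ) + 1) = K * ((N : ℝ) + 1) ^ 2 := by ring
    _ ≤ K * ((N : ℝ) + 2) ^ 2 := mul_le_mul_of_nonneg_left h12 hK0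

end Summit.AtomisticToContinuum.HydrodynamicLimit.Theorems

namespace Summit.AtomisticToContinuum.HydrodynamicLimit.Cruxes.MaxSpeedBoundLog.Birth

open Summit.AtomisticToContinuum.HydrodynamicLimit.Theorems

/-- **Stub 1 of the line `registered` of `MaxSpeedBoundLog` (STATIC extreme-value tail of the
local Gibbs law at the logarithmic level).**  For continuous profiles `a₀, θ₀ > 0`, `u₀`, every
`σ > 0` and every family of hard-sphere flows `Φ` there is `C₀` with
`localGibbsLaw σ a₀ u₀ θ₀ N (Φ N) {z | ∃ i, C₀ √log(N+2) < ‖(z i).2‖} → 0` as `N → ∞`.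
The law does not depend on the flow (`localGibbsLaw_eq`); conditionally on the positions the
velocities are independent Gaussians `N(u₀(qᵢ), θ₀(qᵢ) id)` with `θ₀ ≤ θ_max`, `‖u₀‖ ≤ U`
(compact torus), whence a uniform one-body exponential moment (Fernique) and, by Markov for the
empirical exponential moment (position weight of mass `Z⁻¹ Z ≤ 1`, so every `σ` is allowed, the
`Z = 0` branch being the zero measure), the bound `(N+1) K (N+2)^{-2} → 0` at `C₀ = √(2/a)`
(`exists_tendsto_localGibbsMeasure_existsFast_sqrtLog`). -/
theorem stub_initialSpeedTailLog :
    ∀ (a₀ θ₀ : Literature.MathematicalPhysics.KineticTheory.T3 → ℝ)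
      (u₀ : Literature.MathematicalPhysics.KineticTheory.T3 → Literature.MathematicalPhysics.KineticTheory.V3),
      Continuous a₀ → Continuous θ₀ → Continuous u₀ → (∀ x, 0 < a₀ x) → (∀ x, 0 < θ₀ x) →
      ∀ σ : ℝ, 0 < σ →
      ∀ Φ : (N : ℕ) → Literature.Analysis.FluidPDE.HardSphereFlow
          (Literature.Analysis.FluidPDE.Torus.geometry (Fin 3))
          (Literature.MathematicalPhysics.KineticTheory.hsDiameter σ N) (N + 1),
      ∃ C₀ : ℝ, Filter.Tendsto (fun N : ℕ => Literature.MathematicalPhysics.KineticTheory.localGibbsLaw σ a₀ u₀ θ₀ N (Φ N)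
        {z | ∃ i, C₀ * Real.sqrt (Real.log ((N : ℝ) + 2)) < ‖(z i).2‖}) Filter.atTop (nhds 0) := by
  intro a₀ θ₀ u₀ ha hθ hu ha0 hθ0 σ _hσ Φ
  obtain ⟨C₀, -, hC₀⟩ :=
    exists_tendsto_localGibbsMeasure_existsFast_sqrtLog ha hθ hu (fun x => (ha0 x).le) hθ0
  exact ⟨C₀, (hC₀ σ).congr fun N => by rw [localGibbsLaw_eq]⟩

end Summit.AtomisticToContinuum.HydrodynamicLimit.Cruxes.MaxSpeedBoundLog.Birth

end
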